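import Mathlib.Tactic.Sat.FromLRAT
import Std.Tactic.BVDecide
import Literature.Computability.Complexity.CNF
import HarnessLib

/-!
# Importing LRAT UNSAT certificates for the tree's CNFs

An **UNSAT importer**: how a refutation of a concrete `φ : CNF ℕ` (the tree's list-based CNFs of
`CNF.lean`) found by an external SAT solver — as an LRAT certificate (Cruz-Filipe–Heule–Hunt–
Kaufmann–Schneider-Kamp 2017) — becomes the Lean theorem `¬ φ.Satisfiable`, sorry-free. Two
lanes, both bridged here once and for all:

* **Lane A (computational; gate flag `--computational`).** `CNF.toStd φ : Std.Sat.CNF ℕ` is the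
  same formula for core Lean's SAT library, and `Std.Tactic.BVDecide.Reflect.verifyCert` is core's
  *verified* LRAT checker (the one `bv_decide` runs): `CNF.not_satisfiable_of_verifyCert φ cert h`
  turns `h : verifyCert (CNF.toStd φ) cert = true` — discharged by `native_decide`, i.e. by running
  the compiled checker, trust base `Lean.ofReduceBool` — into `¬ φ.Satisfiable`. About a second
  for a 400 KB certificate; the certificate `cert` is the LRAT *text* (not binary) format.
* **Lane B2 (kernel; standard axioms; scalable — the recommended lane, last section).** Mathlib's
  `lrat_proof cert …` command leaves the replayed refutation as private constants `cert.ctx_k`,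
  `cert.proof_(k+1)` of the certificate file; `CNF.eqFmla` + `CNF.not_satisfiable_of_fmlaProof`
  consume them at linear cost (`n = 1960`, `m = 11037` in 25 s).
* **Lane B (kernel; standard axioms only).** Mathlib's `lrat_proof` command / `from_lrat` term
  (`Mathlib.Tactic.Sat.FromLRAT`, M. Carneiro) replays an LRAT proof *inside the kernel* and yields
  the reified propositional theorem `∀ a₀ … a_{n-1} : Prop, ⋁_clauses ⋀_literals …` (its auxiliary
  `Sat.Fmla.proof` constant is private, hence unusable). The shape of that statement is computed
  here by ordinary structural recursion (`ForallProps`, `CNF.reifyProp`, mirroring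
  `Mathlib.Tactic.Sat.buildReify` node for node, driven by the numerals `n m` of the DIMACS header
  so that unfolding needs no list-length arithmetic), so that
  `(from_lrat "<dimacs>" "<lrat>" : ForallProps n (φ.reifyProp m))` elaborates by definitional
  unfolding, and `CNF.not_satisfiable_of_reify` turns it into `¬ φ.Satisfiable`. No custom
  syntax, no new axioms. Measured: a 390 KB certificate (2 470 RUP steps, 42 variables) replays in
  ≈ 30 s, 25 KB in ≈ 3 s; RAT steps are unsupported by Mathlib's replayer (CaDiCaL's LRAT output
  is RUP-only); the certificate file needs `set_option maxRecDepth 100000 in` before the theorem.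
* **Size limit and splitting (cube and conquer, Heule–Kullmann–Wieringa–Biere 2012).** A Lean
  file travels through `lean check` / the gate only up to ≈ 512 KB, so ONE certificate file holds
  ONE LRAT proof of at most a few hundred KB. Bigger refutations are split along cubes:
  `CNF.not_satisfiable_of_cubes` (any covering family of cubes, the cover itself certified by
  UNSAT of the negated cubes) and `CNF.not_satisfiable_of_split` (the complete binary split on
  chosen variables, cover proved here). Each cube's refutation `¬ (φ.withCube cube).Satisfiable`
  is an independent theorem in its own file, by either lane.

## Conventions (DIMACS ↔ `CNF ℕ` ↔ `Std.Sat.CNF ℕ` ↔ reified statement)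

Tree variable `v : ℕ` (0-based) is DIMACS variable `v + 1`; literal `(v, true)` is DIMACS `v+1`,
`(v, false)` is `-(v+1)`; clause `i` of the list (0-based) is LRAT clause id `i + 1`; the DIMACS
text of `φ` is `CNF.toDimacs φ` (= core's `Std.Sat.CNF.dimacs (CNF.toStd φ)`, same shift), whose
header `p cnf n m` has `n = φ.numVars` (for a formula with a literal) and `m = φ.length` — the two
numerals lane B takes (`CNF.varsBelow φ n` is its decidable side condition).

## HOWTO (consumer side; nothing here runs a solver)

1. Write the encoder `enc : Params → CNF ℕ` with its proved meaning, e.g. via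
   `CardinalityCCNF.subsetCNF_satisfiable_iff` or
   `Combinatorics/Additive/TripleProductPropertySAT.tppCNF_satisfiable_iff`; keep it
   kernel-evaluable (lists over `Fin`/`ℕ`, no `Finset.toList`, no noncomputable equivalences).
2. Obtain the DIMACS text of `enc p` by evaluating `CNF.toDimacs (enc p)` with Lean's `eval`
   command in a scratch file through `lean check` (set `H21_LEAN_MAX_LINES` high) and refute it:
   * an instance that solves within seconds: the Lean toolchain itself ships CaDiCaL (2.1.2,
     `<toolchain>/bin/cadical`, the binary `bv_decide` calls), and
     `cadical -q --lrat=true --binary=false in.cnf proof.lrat` (exit code `20` = UNSAT) writes a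
     text LRAT proof that every lane accepts unchanged (RUP steps only, additions numbered
     consecutively from `m + 1`); measured: PHP₇⁶ (42 variables, 133 clauses) in under a second,
     91 KB, replayed by lane A and lane B2 together in 7 s;
   * anything heavier is a `kit compute submit … --tool sat` job (the SAT-toolbelt nodes carry
     `kissat` 4.0.4 and `pysat`, but no `cadical` or `drat-trim` executables — bundle what the
     job needs: a static `drat-trim`, or the toolchain `cadical` together with the toolchain's
     `lib/libc++.so.1`, `libc++abi.so.1`, `libunwind.so.1`, started through the system loader,
     `/lib64/ld-linux-x86-64.so.2 --library-path ./lib ./cadical …`, since its own ELF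
     interpreter path does not exist on the nodes): `kissat --factor=false in.cnf proof.drat`
     (kissat's factoring = bounded variable addition introduces fresh variables, i.e. RAT-only
     lemmas; switch it off) followed by `drat-trim in.cnf proof.drat -L proof.lrat`. For lane A
     the `drat-trim` output must be normalised — renumber the additions consecutively
     `m + 1, m + 2, …` and drop empty deletion lines — because core's checker appends each added
     clause at the end of its clause array and ignores the stated id, so `drat-trim`'s gapped
     numbering derails the hints; Mathlib's replayer (lanes B, B2) takes the output unchanged
     but has no RAT rule (`drat-trim` must report `0 RAT lemmas in core`).
   Bring back `proof.lrat` (text, ≤ a few hundred KB; else split by cubes).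
3. Lane B2 (preferred: standard axioms, linear — see the last section of this file): lay the
   certificate file out as imports · module docstring · `namespace …` · `open …` ·
   `lrat_proof cert "<dimacs>" "<lrat>"` (so `lrat_proof` is the 4th command), then
   `theorem foo_eq : CNF.eqFmla (enc p) cert.ctx_4 = true := by decide +kernel` and
   `theorem foo : ¬ (enc p).Satisfiable := CNF.not_satisfiable_of_fmlaProof foo_eq cert.proof_5`
   (template: `Combinatorics/Additive/TPPCertificateLaneB2.lean`).
   Lane B (small formulas only, `n ≲ 300` variables):
   `theorem foo_vars : (enc p).varsBelow <n> = true := by decide +kernel` (the kernel evaluates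
   the encoder; keep it a SEPARATE lemma — `decide +kernel` inline next to `from_lrat` loses its
   auxiliary lemma; plain `by decide` is fine for small formulas only), then
   `set_option maxRecDepth 100000 in
    theorem foo : ¬ (enc p).Satisfiable :=
      CNF.not_satisfiable_of_reify (n := <n>) (m := <m>) foo_vars (from_lrat "<dimacs>" "<lrat>")`.
   The ascription of `from_lrat` unfolds `enc p` in the elaborator; when that is too slow (many
   thousands of clauses) certify a literal copy instead: `def φLit : CNF ℕ := [[(0, true), …], …]`
   (generated from the DIMACS), `theorem hφ : enc p = φLit := by decide +kernel`, certify `φLit`,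
   and transport with `hφ ▸`. Lane A (fast, `--computational`):
   `theorem foo : ¬ (enc p).Satisfiable :=
      CNF.not_satisfiable_of_verifyCert (enc p) "<lrat>" (by native_decide)`.
4. Conclude the combinatorial statement from the encoder's `…_satisfiable_iff`. Worked, accepted
   instances: `Combinatorics/Additive/TPPCertificates.lean` (`ℤ/7`, `GL₂(𝔽₂)`),
   `Combinatorics/SimpleGraph/CycleFiveIndependenceCertificate.lean`; the SAT direction (a model
   names the sets; a proved Boolean test re-checks them in the kernel) is
   `Combinatorics/Additive/TPPTableTest.lean`.

## References

* L. Cruz-Filipe, M. J. H. Heule, W. A. Hunt Jr., M. Kaufmann, P. Schneider-Kamp, *Efficient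
  certified RAT verification*, CADE 26 (2017), LNCS 10395, 220–236 (the LRAT format).
  [cite: CruzFilipeHeuleHuntKaufmannSchneiderKamp2017, §3]
* M. J. H. Heule, O. Kullmann, S. Wieringa, A. Biere, *Cube and conquer*, HVC 2011, LNCS 7261,
  50–65, §3 (partition by cubes). [cite: HeuleKullmannWieringaBiere2012, §3]
* Lean core `Std.Sat`, `Std.Tactic.BVDecide.LRAT` (H. Böving); Mathlib
  `Mathlib.Tactic.Sat.FromLRAT` (M. Carneiro).
-/

namespace Literature.Computability.Complexity

/-! ### Lane A: core Lean's verified LRAT checker (`Std`) -/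

/-- The tree CNF as a core-library `Std.Sat.CNF ℕ` (same literals `(variable, polarity)`, clause
list as an `Array`). [folklore] -/
def CNF.toStd (φ : CNF ℕ) : Std.Sat.CNF ℕ :=
  ⟨φ.toArray⟩

/-- Core's clause semantics agrees with the tree's. [folklore] -/
theorem Clause.eval_std (σ : ℕ → Bool) (c : Clause ℕ) :
    Std.Sat.CNF.Clause.eval σ c = Clause.eval σ c := by
  induction c with
  | nil => rfl
  | cons l c ih =>
    rw [Std.Sat.CNF.Clause.eval_cons, ih]
    rfl

/-- Core's CNF semantics agrees with the tree's. [folklore] -/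
theorem CNF.eval_toStd (φ : CNF ℕ) (σ : ℕ → Bool) : (CNF.toStd φ).eval σ = φ.eval σ := by
  simp only [Std.Sat.CNF.eval, CNF.toStd, List.all_toArray, CNF.eval]
  exact congrArg _ (funext fun c => Clause.eval_std σ c)

/-- `Std`-unsatisfiability of `CNF.toStd φ` is the negation of the tree's satisfiability.
[folklore] -/
theorem CNF.unsat_toStd_iff (φ : CNF ℕ) : (CNF.toStd φ).Unsat ↔ ¬ φ.Satisfiable := by
  simp only [Std.Sat.CNF.Unsat, CNF.eval_toStd, CNF.Satisfiable, not_exists,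
    Bool.eq_false_eq_not_eq_true]

/-- **Lane A of the UNSAT importer**: if core Lean's verified LRAT checker accepts the
certificate `cert` (LRAT text format) for `CNF.toStd φ`, then `φ` is unsatisfiable. The
hypothesis is discharged by `native_decide` (compiled evaluation, axiom `Lean.ofReduceBool`;
propose with `--computational`). Soundness is core's `verifyCert_correct`.
[cite: CruzFilipeHeuleHuntKaufmannSchneiderKamp2017, §3] -/
theorem CNF.not_satisfiable_of_verifyCert (φ : CNF ℕ) (cert : String)
    (h : Std.Tactic.BVDecide.Reflect.verifyCert (CNF.toStd φ) cert = true) : ¬ φ.Satisfiable :=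
  (CNF.unsat_toStd_iff φ).1 (Std.Tactic.BVDecide.Reflect.verifyCert_correct _ cert h)

/-- The DIMACS text of `φ` (core's printer: variable `v` is written `v + 1`, clauses in order,
header `p cnf <max variable + 1> <number of clauses>`). This is the solver input whose LRAT
refutations the two lanes accept. [folklore] -/
def CNF.toDimacs (φ : CNF ℕ) : String :=
  Std.Sat.CNF.dimacs (CNF.toStd φ)

/-! ### Lane B: the shape of Mathlib's reified LRAT theorems -/

/-- `ForallProps n P` is `∀ a₀ a₁ … a_{n-1} : Prop, P [a₀, …, a_{n-1}]`, by structural recursion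
(outermost binder = head of the list), definitionally unfolding to the iterated `∀` that
`Mathlib.Tactic.Sat.buildReify` produces. [folklore] -/
def ForallProps : ℕ → (List Prop → Prop) → Prop
  | 0, P => P []
  | n + 1, P => ∀ a : Prop, ForallProps n fun ps => P (a :: ps)

/-- Instantiating an `n`-fold universal statement at a list of `n` propositions. [folklore] -/
theorem ForallProps.apply {n : ℕ} {P : List Prop → Prop} (h : ForallProps n P) :
    ∀ ps : List Prop, ps.length = n → P ps := by
  induction n generalizing P with
  | zero => intro ps hps; rw [List.length_eq_zero_iff.1 hps]; exact h
  | succ n ih =>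
    intro ps hps
    match ps, hps with
    | a :: ps, hps => exact ih (h a) ps (by simpa using hps)

/-- The reified form of a literal over the proposition list `ps` ("the literal is falsified"):
positive `(v, true)` ↦ `¬ ps[v]`, negative `(v, false)` ↦ `ps[v]` (out of range ↦ `False`),
as in `Sat.Literal.reify_pos` / `reify_neg`. [folklore] -/
def Literal.reifyProp (ps : List Prop) : Literal ℕ → Prop
  | (v, true) => ¬ ps.getD v False
  | (v, false) => ps.getD v False

/-- The reified form of a clause ("every literal is falsified"): a right-nested conjunction with
the last literal alone, the empty clause ↦ `True` (as `Sat.Clause.reify_and/one/zero`).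
[folklore] -/
def Clause.reifyProp (ps : List Prop) : Clause ℕ → Prop
  | [] => True
  | [l] => Literal.reifyProp ps l
  | l :: l' :: c => Literal.reifyProp ps l ∧ Clause.reifyProp ps (l' :: c)

/-- The reified form of a clause list ("some clause is falsified") as the balanced disjunction
tree of `Mathlib.Tactic.Sat.buildConj`: a node for `m` clauses splits them into the first `m / 2`
and the remaining `m - m / 2`. The clause count `m` is passed explicitly (a numeral in practice,
so that unfolding needs only numeral arithmetic, never the length of the list), `fuel` bounds the
depth; degenerate inputs ↦ `False`. Sound for ANY `m` (`CNF.exists_of_reifyAux`); it coincides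
with Mathlib's statement when `m` is the number of clauses. [folklore] -/
def CNF.reifyAux (ps : List Prop) : ℕ → ℕ → List (Clause ℕ) → Prop
  | 0, _, _ => False
  | _ + 1, _, [] => False
  | _ + 1, 0, _ :: _ => False
  | _ + 1, 1, c :: _ => Clause.reifyProp ps c
  | fuel + 1, m + 2, c :: cs =>
    CNF.reifyAux ps fuel ((m + 2) / 2) ((c :: cs).take ((m + 2) / 2)) ∨
      CNF.reifyAux ps fuel (m + 2 - (m + 2) / 2) ((c :: cs).drop ((m + 2) / 2))

/-- **The body of Mathlib's reified LRAT theorem for `φ`**: for a DIMACS header `p cnf n m` of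
`φ` (so `m = φ.length`), `lrat_proof foo "<dimacs of φ>" …` produces
`foo : ForallProps n (φ.reifyProp m)` up to definitional unfolding. [folklore] -/
def CNF.reifyProp (φ : CNF ℕ) (m : ℕ) (ps : List Prop) : Prop :=
  CNF.reifyAux ps m m φ

/-- All variables of `φ` are below `n` — as a Boolean test (decide it by `decide` or `rfl`; it is
the side condition of lane B, read off the DIMACS header `p cnf n m`). [folklore] -/
def CNF.varsBelow (φ : CNF ℕ) (n : ℕ) : Bool :=
  φ.all fun c => c.all fun l => decide (l.1 < n)

/-- Meaning of `CNF.varsBelow`. [folklore] -/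
theorem CNF.varsBelow_iff {φ : CNF ℕ} {n : ℕ} :
    φ.varsBelow n = true ↔ ∀ c ∈ φ, ∀ l ∈ c, l.1 < n := by
  simp [CNF.varsBelow, List.all_eq_true]

/-- `CNF.numVars` is a valid bound. [folklore] -/
theorem CNF.varsBelow_numVars (φ : CNF ℕ) : φ.varsBelow φ.numVars = true :=
  CNF.varsBelow_iff.2 fun _ hc _ hl => CNF.lt_numVars_of_mem_of_mem hc hl

/-- The propositions "`σ v = true`" for `v < n`. [folklore] -/
def propsOf (σ : ℕ → Bool) (n : ℕ) : List Prop :=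
  (List.range n).map fun v => σ v = true

/-- `propsOf σ n` has length `n`. [folklore] -/
@[simp] theorem length_propsOf (σ : ℕ → Bool) (n : ℕ) : (propsOf σ n).length = n := by
  simp [propsOf]

/-- Looking up `propsOf`. [folklore] -/
theorem getD_propsOf {σ : ℕ → Bool} {n v : ℕ} (hv : v < n) :
    (propsOf σ n).getD v False = (σ v = true) := by
  simp [propsOf, List.getD_eq_getElem?_getD, hv]

/-- Semantics of the reified literal: it holds iff the literal is false. [folklore] -/
theorem Literal.reifyProp_propsOf_iff {σ : ℕ → Bool} {n : ℕ} {l : Literal ℕ} (hl : l.1 < n) :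
    Literal.reifyProp (propsOf σ n) l ↔ l.eval σ = false := by
  obtain ⟨v, b⟩ := l
  have hv : (propsOf σ n).getD v False = (σ v = true) := getD_propsOf hl
  cases b
  · show (propsOf σ n).getD v False ↔ _
    rw [hv]
    simp [Literal.eval]
  · show ¬ (propsOf σ n).getD v False ↔ _
    rw [hv]
    simp [Literal.eval]

/-- Semantics of the reified clause: it holds iff every literal is false. [folklore] -/
theorem Clause.reifyProp_propsOf_iff {σ : ℕ → Bool} {n : ℕ} :
    ∀ {c : Clause ℕ}, (∀ l ∈ c, l.1 < n) →
      (Clause.reifyProp (propsOf σ n) c ↔ ∀ l ∈ c, l.eval σ = false)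
  | [], _ => by simp [Clause.reifyProp]
  | [l], h => by
    simp [Clause.reifyProp, Literal.reifyProp_propsOf_iff (h l (by simp))]
  | l :: l' :: c, h => by
    rw [Clause.reifyProp, Literal.reifyProp_propsOf_iff (h l List.mem_cons_self),
      Clause.reifyProp_propsOf_iff fun l'' hl'' => h l'' (List.mem_cons_of_mem _ hl'')]
    simp

/-- **Soundness of the balanced disjunction, for any clause count `m`**: if it holds, some
clause of the list is reified-true. [folklore] -/
theorem CNF.exists_of_reifyAux {ps : List Prop} :
    ∀ (fuel m : ℕ) (cs : List (Clause ℕ)), CNF.reifyAux ps fuel m cs →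
      ∃ c ∈ cs, Clause.reifyProp ps c
  | 0, _, _, h => by simp [CNF.reifyAux] at h
  | _ + 1, _, [], h => by simp [CNF.reifyAux] at h
  | _ + 1, 0, _ :: _, h => by simp [CNF.reifyAux] at h
  | _ + 1, 1, c :: _, h => ⟨c, List.mem_cons_self, by simpa [CNF.reifyAux] using h⟩
  | fuel + 1, m + 2, c :: cs, h => by
    rw [CNF.reifyAux] at h
    rcases h with h | h
    · obtain ⟨c', hc', h'⟩ := CNF.exists_of_reifyAux fuel _ _ h
      exact ⟨c', List.mem_of_mem_take hc', h'⟩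
    · obtain ⟨c', hc', h'⟩ := CNF.exists_of_reifyAux fuel _ _ h
      exact ⟨c', List.mem_of_mem_drop hc', h'⟩

/-- **Lane B of the UNSAT importer**: Mathlib's reified LRAT theorem for `φ` (`h`, typically
`from_lrat "<CNF.toDimacs φ>" "<lrat>"`, with `n`, `m` the two numbers of the DIMACS header
`p cnf n m`) proves `¬ φ.Satisfiable`, provided every variable of `φ` is `< n` (`hn`, by
`decide`). Standard axioms only. In the certificate file use `set_option maxRecDepth 100000 in`
(the ascription unfolds `ForallProps` `n` binders deep).
[cite: CruzFilipeHeuleHuntKaufmannSchneiderKamp2017, §3] -/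
theorem CNF.not_satisfiable_of_reify {φ : CNF ℕ} {n m : ℕ} (hn : φ.varsBelow n = true)
    (h : ForallProps n (φ.reifyProp m)) : ¬ φ.Satisfiable := by
  rintro ⟨σ, hσ⟩
  have hvars : ∀ c ∈ φ, ∀ l ∈ c, l.1 < n := CNF.varsBelow_iff.1 hn
  have hP := h.apply (propsOf σ n) (length_propsOf σ n)
  obtain ⟨c, hc, hc'⟩ := CNF.exists_of_reifyAux m m φ hP
  rw [Clause.reifyProp_propsOf_iff (hvars c hc)] at hc'
  have := (CNF.eval_eq_true_iff φ σ).1 hσ c hc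
  rw [Clause.eval, List.any_eq_true] at this
  obtain ⟨l, hl, hl'⟩ := this
  rw [hc' l hl] at hl'
  exact Bool.false_ne_true hl'

/-! ### Cube and conquer: splitting one refutation into many -/

universe u

variable {ν : Type u}

/-- `φ` under the cube `cube` (a list of literals assumed true): the unit clauses of the cube
followed by `φ`. [cite: HeuleKullmannWieringaBiere2012, §3] -/
def CNF.withCube (φ : CNF ν) (cube : List (Literal ν)) : CNF ν :=
  cube.map (fun l => [l]) ++ φ

/-- The clause "the cube fails": the negations of its literals.
[cite: HeuleKullmannWieringaBiere2012, §3] -/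
def cubeNegClause (cube : List (Literal ν)) : Clause ν :=
  cube.map Literal.negate

/-- An assignment making every literal of the cube true and `φ` true satisfies `φ.withCube cube`.
[cite: HeuleKullmannWieringaBiere2012, §3] -/
theorem CNF.eval_withCube_eq_true_iff (φ : CNF ν) (cube : List (Literal ν)) (σ : ν → Bool) :
    (φ.withCube cube).eval σ = true ↔ (∀ l ∈ cube, l.eval σ = true) ∧ φ.eval σ = true := by
  simp only [CNF.withCube, CNF.eval_eq_true_iff, List.mem_append, List.mem_map]
  constructor
  · intro h
    refine ⟨fun l hl => ?_, fun c hc => h c (Or.inr hc)⟩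
    have := h [l] (Or.inl ⟨l, hl, rfl⟩)
    simpa [Clause.eval] using this
  · rintro ⟨hcube, hφ⟩ c (⟨l, hl, rfl⟩ | hc)
    · simpa [Clause.eval] using hcube l hl
    · exact hφ c hc

/-- The negated cube clause is true iff some literal of the cube is false.
[cite: HeuleKullmannWieringaBiere2012, §3] -/
theorem eval_cubeNegClause_eq_true_iff (cube : List (Literal ν)) (σ : ν → Bool) :
    Clause.eval σ (cubeNegClause cube) = true ↔ ∃ l ∈ cube, l.eval σ = false := by
  simp [cubeNegClause, Clause.eval, List.any_eq_true]

/-- A conjunction of CNFs that is satisfiable has a satisfiable right part. [folklore] -/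
theorem CNF.Satisfiable.of_append_right {φ ψ : CNF ν} (h : CNF.Satisfiable (φ ++ ψ)) :
    ψ.Satisfiable := by
  obtain ⟨σ, hσ⟩ := h
  rw [CNF.eval, List.all_append, Bool.and_eq_true] at hσ
  exact ⟨σ, hσ.2⟩

/-- **Cube and conquer**: if no assignment satisfies `φ` while failing every cube (the *cover*
condition, itself an UNSAT statement about `φ ++ [¬cube₁, …, ¬cube_m]`), and `φ` is
unsatisfiable under each cube, then `φ` is unsatisfiable. [cite: HeuleKullmannWieringaBiere2012, §3] -/
theorem CNF.not_satisfiable_of_cubes (φ : CNF ν) (cubes : List (List (Literal ν)))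
    (hcover : ¬ CNF.Satisfiable (φ ++ cubes.map cubeNegClause))
    (h : ∀ cube ∈ cubes, ¬ (φ.withCube cube).Satisfiable) : ¬ φ.Satisfiable := by
  rintro ⟨σ, hσ⟩
  by_cases hall : ∃ cube ∈ cubes, ∀ l ∈ cube, l.eval σ = true
  · obtain ⟨cube, hcube, hlits⟩ := hall
    exact h cube hcube ⟨σ, (CNF.eval_withCube_eq_true_iff φ cube σ).2 ⟨hlits, hσ⟩⟩
  · push Not at hall
    refine hcover ⟨σ, ?_⟩
    rw [CNF.eval, List.all_append, Bool.and_eq_true]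
    refine ⟨hσ, List.all_eq_true.2 fun c hc => ?_⟩
    obtain ⟨cube, hcube, rfl⟩ := List.mem_map.1 hc
    obtain ⟨l, hl, hl'⟩ := hall cube hcube
    exact (eval_cubeNegClause_eq_true_iff cube σ).2 ⟨l, hl, by simpa using hl'⟩

/-- Cube and conquer with a cover that does not mention `φ`: it suffices that the negated cubes
alone are jointly unsatisfiable. [cite: HeuleKullmannWieringaBiere2012, §3] -/
theorem CNF.not_satisfiable_of_cubes' (φ : CNF ν) (cubes : List (List (Literal ν)))
    (hcover : ¬ CNF.Satisfiable (cubes.map cubeNegClause))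
    (h : ∀ cube ∈ cubes, ¬ (φ.withCube cube).Satisfiable) : ¬ φ.Satisfiable :=
  CNF.not_satisfiable_of_cubes φ cubes (fun hs => hcover hs.of_append_right) h

/-- All `2^d` cubes (sign patterns) on the variables `xs`, first variable outermost.
[cite: HeuleKullmannWieringaBiere2012, §3] -/
def cubesOn : List ν → List (List (Literal ν))
  | [] => [[]]
  | x :: xs => (cubesOn xs).map (fun cube => (x, true) :: cube) ++
      (cubesOn xs).map (fun cube => (x, false) :: cube)

/-- Every assignment realises one of the complete cubes. [cite: HeuleKullmannWieringaBiere2012, §3] -/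
theorem exists_mem_cubesOn_all_true (σ : ν → Bool) :
    ∀ xs : List ν, ∃ cube ∈ cubesOn xs, ∀ l ∈ cube, l.eval σ = true
  | [] => ⟨[], by simp [cubesOn], by simp⟩
  | x :: xs => by
    obtain ⟨cube, hcube, hall⟩ := exists_mem_cubesOn_all_true σ xs
    cases hx : σ x
    · refine ⟨(x, false) :: cube, ?_, ?_⟩
      · simp only [cubesOn, List.mem_append, List.mem_map]
        exact Or.inr ⟨cube, hcube, rfl⟩
      · intro l hl
        rcases List.mem_cons.1 hl with rfl | hl
        · simp [Literal.eval, hx]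
        · exact hall l hl
    · refine ⟨(x, true) :: cube, ?_, ?_⟩
      · simp only [cubesOn, List.mem_append, List.mem_map]
        exact Or.inl ⟨cube, hcube, rfl⟩
      · intro l hl
        rcases List.mem_cons.1 hl with rfl | hl
        · simp [Literal.eval, hx]
        · exact hall l hl

/-- **Complete binary split**: if `φ` is unsatisfiable under each of the `2^d` cubes on the
variables `xs`, it is unsatisfiable. [cite: HeuleKullmannWieringaBiere2012, §3] -/
theorem CNF.not_satisfiable_of_split (φ : CNF ν) (xs : List ν)
    (h : ∀ cube ∈ cubesOn xs, ¬ (φ.withCube cube).Satisfiable) : ¬ φ.Satisfiable := by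
  rintro ⟨σ, hσ⟩
  obtain ⟨cube, hcube, hall⟩ := exists_mem_cubesOn_all_true σ xs
  exact h cube hcube ⟨σ, (CNF.eval_withCube_eq_true_iff φ cube σ).2 ⟨hall, hσ⟩⟩

/-! ### Worked example (lane B, kernel-checked)

The CNF `(x₀ ∨ x₁) ∧ (¬x₀ ∨ x₁) ∧ (x₀ ∨ ¬x₁) ∧ (¬x₀ ∨ ¬x₁)` and the 4-step LRAT refutation from the
`Mathlib.Tactic.Sat.FromLRAT` documentation; `CNF.toDimacs` of this list is exactly the DIMACS
string below. -/

/-- The textbook unsatisfiable 2-variable CNF: all four clauses on `x₀, x₁`. [folklore] -/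
def CNF.allFourClauses : CNF ℕ :=
  [[(0, true), (1, true)], [(0, false), (1, true)], [(0, true), (1, false)], [(0, false), (1, false)]]

/-- `CNF.allFourClauses` is unsatisfiable — by importing an LRAT certificate through lane B
(kernel replay, standard axioms). [folklore] -/
theorem CNF.not_satisfiable_allFourClauses : ¬ CNF.allFourClauses.Satisfiable :=
  CNF.not_satisfiable_of_reify (n := 2) (m := 4) (by decide) (from_lrat
    "p cnf 2 4  1 2 0  -1 2 0  1 -2 0  -1 -2 0"
    "5 -2 0 4 3 0  5 d 3 4 0  6 1 0 5 1 0  6 d 1 0  7 0 5 2 6 0")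


/-! ### Assembling split certificates (appended 2026-08-16)

The conjunction form of "every cube is refuted", so that `2^d` independently certified theorems
`tᵢ : ¬ (φ.withCube cubeᵢ).Satisfiable` assemble by
`CNF.not_satisfiable_of_allRefuted_split φ xs (.cons t₁ (.cons t₂ (… .nil)))` — the cube order
is that of `cubesOn xs` (first variable outermost, `true` before `false`). -/

/-- `φ.AllRefuted cubes`: `φ` is unsatisfiable under each cube of the list, as a right-nested
conjunction in list order. [cite: HeuleKullmannWieringaBiere2012, §3] -/
def CNF.AllRefuted (φ : CNF ν) : List (List (Literal ν)) → Prop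
  | [] => True
  | cube :: cubes => ¬ (φ.withCube cube).Satisfiable ∧ CNF.AllRefuted φ cubes

/-- No cubes, nothing to refute. [cite: HeuleKullmannWieringaBiere2012, §3] -/
theorem CNF.AllRefuted.nil {φ : CNF ν} : φ.AllRefuted [] :=
  trivial

/-- Adding one refuted cube in front. [cite: HeuleKullmannWieringaBiere2012, §3] -/
theorem CNF.AllRefuted.cons {φ : CNF ν} {cube : List (Literal ν)} {cubes : List (List (Literal ν))}
    (h : ¬ (φ.withCube cube).Satisfiable) (hs : φ.AllRefuted cubes) :
    φ.AllRefuted (cube :: cubes) :=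
  ⟨h, hs⟩

/-- The conjunction says exactly that every listed cube is refuted.
[cite: HeuleKullmannWieringaBiere2012, §3] -/
theorem CNF.allRefuted_iff {φ : CNF ν} :
    ∀ {cubes : List (List (Literal ν))},
      φ.AllRefuted cubes ↔ ∀ cube ∈ cubes, ¬ (φ.withCube cube).Satisfiable
  | [] => by simp [CNF.AllRefuted]
  | cube :: cubes => by
    rw [CNF.AllRefuted, CNF.allRefuted_iff]
    simp

/-- **Assembly of a complete binary split**: the `2^d` cube refutations, as a conjunction in the
order of `cubesOn xs`, refute `φ`. [cite: HeuleKullmannWieringaBiere2012, §3] -/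
theorem CNF.not_satisfiable_of_allRefuted_split (φ : CNF ν) (xs : List ν)
    (h : φ.AllRefuted (cubesOn xs)) : ¬ φ.Satisfiable :=
  CNF.not_satisfiable_of_split φ xs (CNF.allRefuted_iff.1 h)

/-- **Assembly of a certified cover**: cube refutations in list order plus an UNSAT certificate
for the negated cubes refute `φ`. [cite: HeuleKullmannWieringaBiere2012, §3] -/
theorem CNF.not_satisfiable_of_allRefuted_cubes (φ : CNF ν) (cubes : List (List (Literal ν)))
    (hcover : ¬ CNF.Satisfiable (cubes.map cubeNegClause)) (h : φ.AllRefuted cubes) :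
    ¬ φ.Satisfiable :=
  CNF.not_satisfiable_of_cubes' φ cubes hcover (CNF.allRefuted_iff.1 h)

/-- Worked split (both cubes on `x₀` of `CNF.allFourClauses`, each refuted by a 2-step LRAT proof
through lane B; the unit clause of the cube is DIMACS clause `1`). [folklore] -/
theorem CNF.not_satisfiable_allFourClauses_bySplit : ¬ CNF.allFourClauses.Satisfiable :=
  CNF.not_satisfiable_of_allRefuted_split _ [0]
    (.cons (CNF.not_satisfiable_of_reify (n := 2) (m := 5) (by decide) (from_lrat
        "p cnf 2 5  1 0  1 2 0  -1 2 0  1 -2 0  -1 -2 0"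
        "6 2 0 1 3 0  7 0 1 6 5 0"))
      (.cons (CNF.not_satisfiable_of_reify (n := 2) (m := 5) (by decide) (from_lrat
        "p cnf 2 5  -1 0  1 2 0  -1 2 0  1 -2 0  -1 -2 0"
        "6 2 0 1 2 0  7 0 1 6 4 0"))
        .nil))


/-! ### Side conditions of cube files (appended 2026-08-16) -/

/-- The variables of `φ.withCube cube` are below `n` as soon as those of `φ` and of the cube are:
cube certificate files reuse the base formula's `varsBelow` lemma. [folklore] -/
theorem CNF.varsBelow_withCube {φ : CNF ℕ} {n : ℕ} (hφ : φ.varsBelow n = true)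
    {cube : List (Literal ℕ)} (hcube : ∀ l ∈ cube, l.1 < n) :
    (φ.withCube cube).varsBelow n = true := by
  rw [CNF.varsBelow_iff] at hφ ⊢
  intro c hc l hl
  simp only [CNF.withCube, List.mem_append, List.mem_map] at hc
  rcases hc with ⟨l', hl', rfl⟩ | hc
  · rw [List.mem_singleton] at hl
    rw [hl]
    exact hcube l' hl'
  · exact hφ c hc l hl

/-- All literals of all complete cubes on `xs` have their variable in `xs`. [folklore] -/
theorem mem_of_mem_cubesOn {ν : Type u} {xs : List ν} :
    ∀ {cube : List (Literal ν)}, cube ∈ cubesOn xs → ∀ l ∈ cube, l.1 ∈ xs := by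
  induction xs with
  | nil => intro cube hc l hl; simp [cubesOn] at hc; subst hc; simp at hl
  | cons x xs ih =>
    intro cube hc l hl
    simp only [cubesOn, List.mem_append, List.mem_map] at hc
    rcases hc with ⟨c, hc, rfl⟩ | ⟨c, hc, rfl⟩ <;>
    · rcases List.mem_cons.1 hl with rfl | hl
      · simp
      · exact List.mem_cons_of_mem _ (ih hc l hl)

/-- The side condition for every cube of a complete split, from that of `φ` and a bound on the
split variables. [folklore] -/
theorem CNF.varsBelow_withCube_of_mem_cubesOn {φ : CNF ℕ} {n : ℕ} (hφ : φ.varsBelow n = true)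
    {xs : List ℕ} (hxs : ∀ x ∈ xs, x < n) {cube : List (Literal ℕ)} (hc : cube ∈ cubesOn xs) :
    (φ.withCube cube).varsBelow n = true :=
  CNF.varsBelow_withCube hφ fun l hl => hxs _ (mem_of_mem_cubesOn hc l hl)


/-! ### Lane B2: Mathlib's `lrat_proof` certificate constants, flattened comparison (appended 2026-08-16)

The SCALABLE standard-axioms lane. Lane B ascribes the reified `∀`-statement, which the kernel
compares binder by binder — cost `n · |φ|`, measured to exhaust kernel memory from `n ≈ 2000`
variables. Mathlib's `lrat_proof cert "<dimacs>" "<lrat>"` command, however, first creates two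
*private* constants of the certificate file itself — `cert.ctx_k : Sat.Fmla` (the formula, a
balanced `Sat.Fmla.and` tree) and `cert.proof_(k+1) : cert.ctx_k.proof []` (the kernel-replayed
refutation) — and private constants are nameable by their short name inside their own file. Lane B2
consumes them directly: `CNF.eqFmla φ cert.ctx_k` is a Boolean comparison (decided by
`decide +kernel`, one linear kernel evaluation that runs the encoder and flattens the tree), and
`CNF.not_satisfiable_of_fmlaProof` turns it plus `cert.proof_(k+1)` into `¬ φ.Satisfiable`.
Everything is linear; measured: `n = 1960`, `m = 11037` (the `GL₂(𝔽₃)` TPP encoding) in 25 s.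

The index `k`: `cert.ctx_k` / `cert.proof_(k+1)` where `k` is the ordinal of the `lrat_proof`
command among the file's top-level commands — imports not counted, the module docstring,
`namespace`, `open`, `set_option` one each (so the canonical layout imports · module docstring ·
`namespace …` · `open …` · `lrat_proof cert …` gives `cert.ctx_4`, `cert.proof_5`, as in
`Combinatorics/Additive/TPPCertificateLaneB2.lean`); declarations before it advance the counter
by more — keep the `lrat_proof` ahead of every declaration, or read the index off one `lean check`
with `#check cert.ctx_4` (remove the `#check` before proposing). Measured with Lean 4.32 /
Mathlib's `FromLRAT` of this tree; a wrong index is an elaboration error, never unsound. -/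

/-- The tree literal as a `Sat.Literal` of Mathlib's LRAT replayer (`(v, true) ↦ pos v`,
`(v, false) ↦ neg v`; same 0-based variables). [folklore] -/
def Literal.toSat : Literal ℕ → Sat.Literal
  | (v, true) => Sat.Literal.pos v
  | (v, false) => Sat.Literal.neg v

/-- The tree CNF as a `Sat.Fmla` (list of clauses of `Sat.Literal`s). [folklore] -/
def CNF.toFmla (φ : CNF ℕ) : Sat.Fmla :=
  φ.map fun c => c.map Literal.toSat

/-- Boolean equality test of a tree literal against a `Sat.Literal` (which carries no
`DecidableEq`). [folklore] -/
def Literal.eqSat : Literal ℕ → Sat.Literal → Bool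
  | (v, true), Sat.Literal.pos w => v == w
  | (v, false), Sat.Literal.neg w => v == w
  | _, _ => false

/-- Boolean equality test of a tree clause against a `Sat.Clause`. [folklore] -/
def Clause.eqSat : Clause ℕ → Sat.Clause → Bool
  | [], [] => true
  | l :: c, l' :: c' => Literal.eqSat l l' && Clause.eqSat c c'
  | _, _ => false

/-- **The side condition of lane B2**: Boolean equality test of a tree CNF against a `Sat.Fmla`
(decide `CNF.eqFmla φ cert.ctx_k = true` by `decide +kernel`). [folklore] -/
def CNF.eqFmla : CNF ℕ → Sat.Fmla → Bool
  | [], [] => true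
  | c :: φ, c' :: f => Clause.eqSat c c' && CNF.eqFmla φ f
  | _, _ => false

/-- A passed literal test is an equality. [folklore] -/
theorem Literal.toSat_eq_of_eqSat :
    ∀ {l : Literal ℕ} {l' : Sat.Literal}, Literal.eqSat l l' = true → l.toSat = l'
  | (v, true), Sat.Literal.pos w, h => by simp [Literal.eqSat] at h; subst h; rfl
  | (v, false), Sat.Literal.neg w, h => by simp [Literal.eqSat] at h; subst h; rfl
  | (v, true), Sat.Literal.neg w, h => by simp [Literal.eqSat] at h
  | (v, false), Sat.Literal.pos w, h => by simp [Literal.eqSat] at h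

/-- A passed clause test is an equality. [folklore] -/
theorem Clause.map_toSat_eq_of_eqSat :
    ∀ {c : Clause ℕ} {c' : Sat.Clause}, Clause.eqSat c c' = true → c.map Literal.toSat = c'
  | [], [], _ => rfl
  | l :: c, l' :: c', h => by
    simp only [Clause.eqSat, Bool.and_eq_true] at h
    show Literal.toSat l :: c.map Literal.toSat = l' :: c'
    rw [Literal.toSat_eq_of_eqSat h.1, Clause.map_toSat_eq_of_eqSat h.2]
  | [], _ :: _, h => by simp [Clause.eqSat] at h
  | _ :: _, [], h => by simp [Clause.eqSat] at h

/-- A passed formula test is an equality `CNF.toFmla φ = f`. [folklore] -/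
theorem CNF.toFmla_eq_of_eqFmla :
    ∀ {φ : CNF ℕ} {f : Sat.Fmla}, CNF.eqFmla φ f = true → CNF.toFmla φ = f
  | [], [], _ => rfl
  | c :: φ, c' :: f, h => by
    simp only [CNF.eqFmla, Bool.and_eq_true] at h
    show c.map Literal.toSat :: CNF.toFmla φ = c' :: f
    rw [Clause.map_toSat_eq_of_eqSat h.1, CNF.toFmla_eq_of_eqFmla h.2]
    rfl
  | [], _ :: _, h => by simp [CNF.eqFmla] at h
  | _ :: _, [], h => by simp [CNF.eqFmla] at h

/-- A tree assignment as a `Sat.Valuation` (`v n := (σ n = true)`). [folklore] -/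
def valuationOf (σ : ℕ → Bool) : Sat.Valuation :=
  fun n => σ n = true

/-- A literal is falsified in Mathlib's sense iff it evaluates to `false`. [folklore] -/
theorem neg_toSat_iff (σ : ℕ → Bool) (l : Literal ℕ) :
    (valuationOf σ).neg l.toSat ↔ l.eval σ = false := by
  rcases l with ⟨v, _ | _⟩ <;> simp [Literal.toSat, Sat.Valuation.neg, valuationOf, Literal.eval]

/-- A clause is satisfied in Mathlib's sense iff it evaluates to `true`. [folklore] -/
theorem satisfies_map_toSat_iff (σ : ℕ → Bool) :
    ∀ c : Clause ℕ, (valuationOf σ).satisfies (c.map Literal.toSat) ↔ Clause.eval σ c = true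
  | [] => by simp [Sat.Valuation.satisfies, Clause.eval]
  | l :: c => by
    rw [List.map_cons, Sat.Valuation.satisfies, neg_toSat_iff, satisfies_map_toSat_iff σ c]
    simp only [Clause.eval, List.any_cons, Bool.or_eq_true]
    constructor
    · intro h
      by_cases hl : Literal.eval σ l = true
      · exact Or.inl hl
      · exact Or.inr (h (by simpa using hl))
    · rintro (h | h) hl
      · rw [h] at hl; exact absurd hl (by simp)
      · exact h

/-- **Lane B2 of the UNSAT importer**: after `lrat_proof cert "<CNF.toDimacs φ>" "<lrat>"` in the
certificate file, `CNF.not_satisfiable_of_fmlaProof h cert.proof_(k+1)` with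
`h : CNF.eqFmla φ cert.ctx_k = true` (by `decide +kernel`) proves `¬ φ.Satisfiable`. Linear in the
formula and the certificate; standard axioms. [cite: CruzFilipeHeuleHuntKaufmannSchneiderKamp2017, §3] -/
theorem CNF.not_satisfiable_of_fmlaProof {φ : CNF ℕ} {f : Sat.Fmla} (h : CNF.eqFmla φ f = true)
    (hp : Sat.Fmla.proof f []) : ¬ φ.Satisfiable := by
  rintro ⟨σ, hσ⟩
  have hf := CNF.toFmla_eq_of_eqFmla h
  subst hf
  refine hp (valuationOf σ) ⟨fun c hc => ?_⟩
  obtain ⟨c₀, hc₀, rfl⟩ := List.mem_map.1 hc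
  exact (satisfies_map_toSat_iff σ c₀).2 ((CNF.eval_eq_true_iff φ σ).1 hσ c₀ hc₀)

end Literature.Computability.Complexity
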